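import Summits.AtomisticToContinuum.Crystallization.Theorems.FreeSplittingCertificatesStrictSplittingRuleP1PayNear

/-!
# `StrictSplittingRule` (stmt-AtomisticToContinuum-12560): the INTEGER FRAME of the hcp sites and the vertex-moment tables of the carriers of a loaded leg (P1 interpolant object, part 95)

Route `FreeSplittingCertificates`, crux r3 `StrictSplittingRule` (H12⋆ = `stub_coreJointCoercive`), unit b2b-freesplit-B gen 40.
VALUE = second brick of the sharper (B∃) tail lemma (kernel radius `44a → 20a`).  Part 94's Jensen capacity of a leg `(x, d)` needs an
upper bound of the MEAN vertex second moment `(1/4n)·Σ_{carriers T'} Σ_m |y_{T',m} − y_p|²` about the base site.  Writing every carrier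
vertex as `y_{x+u}` and `y_{x+u} − y_x` in the integer frame `(a/2, a√3/6, h)` (the hcp sites of an even layer are `a(i + j/2, √3j/2, ·)`,
of an odd layer shifted by `a(1/2, √3/6, ·)`), that mean is `|y_x − y_p|² + 2⟨y_x − y_p, ū⟩ + (1/4n)Σ|u|²` with `ū` the vertex mean —
an exact polynomial in `a, h` with INTEGER data per leg class, and the first-order term is `2⟨y_x − y_p, ū⟩`: relative to the bond
midpoint (where the tension is bounded, part 94) the lever is `|ū − (b − y_x)| = 0.096a` (in-layer legs) / `a/2` (route legs) instead
of part 87's `(5/6 + 99/70)a`.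
* `p1Frame`, `p1FrameVec`, **`hcpSite_shift_eq_frame`** (`y_{x+u} − y_x = Φ(F_b(u))`, both parities), `fpSq_p1FrameVec`;
* `p1CarS1`, `p1CarQ` (integer first / second vertex-moment sums of the tabulated carriers of part 86), `p1CarCheck` (the two integer
  inequalities encoding `|ū − μ| ≤ 1/2` and `variance ≤ (3/5)` on the box) — checked for all 12 leg classes and all three bond
  positions `μ` (in-layer bond = leg; first / second leg of the routed vertical bond) by `decide`;
* `carrier_moment_eq` (the expansion), `moment_abstract`, `p1CarCheck_real`, **`carriers_moment_le`**: the hypothesis of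
  `cap_ge_carriers_tangent` with `X = (27/25)·m_b²`, `m_b` = distance from `y_p` to the bond midpoint `≥ 93/5`.
NOT a proof of H12⋆, NOT summit progress.  [folklore: parallel-axis theorem; hcp coordinates]
-/

noncomputable section

open Set Function Metric MeasureTheory Filter Topology
open scoped BigOperators NNReal ENNReal Classical

namespace Summit.AtomisticToContinuum.Crystallization.Theorems.StrictSplittingRuleBirth

open Literature.MathematicalPhysics.StatisticalMechanics
open Summit.AtomisticToContinuum.Crystallization.Theorems.PalmUnimodularRigidity.LayeredLawsSelectHcp

/-! ## The integer frame -/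

/-- **Integer frame coordinates** of `y_{x+u} − y_x` for a base `x` of parity `b`, in units `(a/2, a√3/6, h)`:
even base `(2i + j + t, 3j + t, k)`, odd base `(2i + j − t, 3j − t, k)`, `u = (k,i,j)`, `t = [k odd]`. [folklore] -/
def p1Frame (b : Bool) (u : ℤ × ℤ × ℤ) : ℤ × ℤ × ℤ :=
  if b then (2 * u.2.1 + u.2.2 + (if Even u.1 then 0 else 1), 3 * u.2.2 + (if Even u.1 then 0 else 1), u.1)
  else (2 * u.2.1 + u.2.2 - (if Even u.1 then 0 else 1), 3 * u.2.2 - (if Even u.1 then 0 else 1), u.1)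

/-- The real vector with integer frame coordinates `F`: `(a/2·F₁, a√3/6·F₂, h·F₃)`. [folklore] -/
def p1FrameVec (a h : ℝ) (F : ℤ × ℤ × ℤ) : Fin 3 → ℝ := ![a / 2 * F.1, a * √3 / 6 * F.2.1, h * F.2.2]

/-- First frame coordinate. -/
@[simp] theorem p1FrameVec_apply0 (a h : ℝ) (F : ℤ × ℤ × ℤ) : p1FrameVec a h F 0 = a / 2 * F.1 := rfl
/-- Second frame coordinate. -/
@[simp] theorem p1FrameVec_apply1 (a h : ℝ) (F : ℤ × ℤ × ℤ) : p1FrameVec a h F 1 = a * √3 / 6 * F.2.1 := rfl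
/-- Third frame coordinate. -/
@[simp] theorem p1FrameVec_apply2 (a h : ℝ) (F : ℤ × ℤ × ℤ) : p1FrameVec a h F 2 = h * F.2.2 := rfl

/-- **`y_{x+u} − y_x = Φ(F_b(u))`** for `x` of parity `b` (even layers translate, odd layers invert: parts 42/73). [folklore] -/
theorem hcpSite_shift_eq_frame (a h : ℝ) {x : ℤ × ℤ × ℤ} {b : Bool} (hb : p1Par x = b) (u : ℤ × ℤ × ℤ) (k : Fin 3) :
    hcpSite a h (x + u) k - hcpSite a h x k = p1FrameVec a h (p1Frame b u) k := by
  cases b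
  · have hodd : Odd x.1 := Int.not_even_iff_odd.1 (by simpa [p1Par] using hb)
    have e : x + u = x - (-u) := by abel
    rw [e, hcpSite_sub_of_odd a h hodd]
    rcases Int.even_or_odd u.1 with hu | hu
    · have hl : haggLabel alternatingHagg (-u.1) = 0 := haggLabel_alternating_of_even hu.neg
      fin_cases k <;>
        simp [hcpSite_apply_zero, hcpSite_apply_one, hcpSite_apply_two, p1Frame, hl, hu] <;> ring
    · have hu' : ¬Even u.1 := Int.not_even_iff_odd.2 hu
      have hl : haggLabel alternatingHagg (-u.1) = 1 := haggLabel_alternating_of_odd hu.neg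
      fin_cases k <;>
        simp [hcpSite_apply_zero, hcpSite_apply_one, hcpSite_apply_two, p1Frame, hl, hu'] <;> ring
  · have heven : Even x.1 := by simpa [p1Par] using hb
    rw [hcpSite_add_of_even a h heven]
    rcases Int.even_or_odd u.1 with hu | hu
    · have hl : haggLabel alternatingHagg u.1 = 0 := haggLabel_alternating_of_even hu
      fin_cases k <;>
        simp [hcpSite_apply_zero, hcpSite_apply_one, hcpSite_apply_two, p1Frame, hl, hu] <;> ring
    · have hu' : ¬Even u.1 := Int.not_even_iff_odd.2 hu
      have hl : haggLabel alternatingHagg u.1 = 1 := haggLabel_alternating_of_odd hu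
      fin_cases k <;>
        simp [hcpSite_apply_zero, hcpSite_apply_one, hcpSite_apply_two, p1Frame, hl, hu'] <;> ring

/-- `|Φ(F)|² = (a²/4)F₁² + (a²/12)F₂² + h²F₃²`. -/
theorem fpSq_p1FrameVec (a h : ℝ) (F : ℤ × ℤ × ℤ) :
    fpSq (p1FrameVec a h F) = a ^ 2 / 4 * (F.1 : ℝ) ^ 2 + a ^ 2 / 12 * (F.2.1 : ℝ) ^ 2 + h ^ 2 * (F.2.2 : ℝ) ^ 2 := by
  have h3 : (√3 : ℝ) ^ 2 = 3 := Real.sq_sqrt (by norm_num)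
  simp only [fpSq, p1FrameVec_apply0, p1FrameVec_apply1, p1FrameVec_apply2]
  nlinarith [h3]

/-! ## The integer vertex-moment tables of the carriers -/

/-- **First vertex-moment sum** of the carriers of leg class `(b, d)`: `Σ_{(o,π)} Σ_m F_b(o_m − o)` (integer frame). [folklore] -/
def p1CarS1 (b : Bool) (d : ℤ × ℤ × ℤ) : ℤ × ℤ × ℤ :=
  ∑ oπ ∈ p1Carriers b d, ∑ m : Fin 4, p1Frame b (p1VertOff (parOf b oπ.1) oπ.2 m - oπ.1)

/-- **Second vertex-moment sums** (per frame coordinate) of the carriers of leg class `(b, d)`. [folklore] -/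
def p1CarQ (b : Bool) (d : ℤ × ℤ × ℤ) : ℤ × ℤ × ℤ :=
  ∑ oπ ∈ p1Carriers b d, ∑ m : Fin 4,
    ((p1Frame b (p1VertOff (parOf b oπ.1) oπ.2 m - oπ.1)).1 ^ 2, (p1Frame b (p1VertOff (parOf b oπ.1) oπ.2 m - oπ.1)).2.1 ^ 2,
      (p1Frame b (p1VertOff (parOf b oπ.1) oπ.2 m - oπ.1)).2.2 ^ 2)

/-- **The two integer inequalities of a leg class against a bond-midpoint offset `μ = Φ(Mv)/2`**: with `N = 4n`, `S = p1CarS1`,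
`Q = p1CarQ`, `K = 2S − N·Mv`, `A_c = N·Q_c − S_c²`: `9437(3K₁² + K₂²) + 75480K₃² ≤ 120000N²` (i.e. `|ū − μ| ≤ 1/2` on the box,
`a² ≤ 0.9437`, `h² ≤ 0.629`) and `A_c ≥ 0`, `9437(3A₁ + A₂) + 75480A₃ ≤ 72000N²` (vertex variance `≤ 3/5`). [folklore] -/
def p1CarCheck (b : Bool) (d Mv : ℤ × ℤ × ℤ) : Prop :=
  9437 * (3 * (2 * (p1CarS1 b d).1 - 4 * (p1Carriers b d).card * Mv.1) ^ 2 + (2 * (p1CarS1 b d).2.1 - 4 * (p1Carriers b d).card * Mv.2.1) ^ 2) +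
      75480 * (2 * (p1CarS1 b d).2.2 - 4 * (p1Carriers b d).card * Mv.2.2) ^ 2 ≤ 120000 * (4 * (p1Carriers b d).card : ℤ) ^ 2 ∧
    0 ≤ 4 * (p1Carriers b d).card * (p1CarQ b d).1 - (p1CarS1 b d).1 ^ 2 ∧
    0 ≤ 4 * (p1Carriers b d).card * (p1CarQ b d).2.1 - (p1CarS1 b d).2.1 ^ 2 ∧
    0 ≤ 4 * (p1Carriers b d).card * (p1CarQ b d).2.2 - (p1CarS1 b d).2.2 ^ 2 ∧
    9437 * (3 * (4 * (p1Carriers b d).card * (p1CarQ b d).1 - (p1CarS1 b d).1 ^ 2) +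
        (4 * (p1Carriers b d).card * (p1CarQ b d).2.1 - (p1CarS1 b d).2.1 ^ 2)) +
      75480 * (4 * (p1Carriers b d).card * (p1CarQ b d).2.2 - (p1CarS1 b d).2.2 ^ 2) ≤ 72000 * (4 * (p1Carriers b d).card : ℤ) ^ 2

/-- The class checks are decidable integer inequalities. -/
instance instDecidableP1CarCheck (b : Bool) (d Mv : ℤ × ℤ × ℤ) : Decidable (p1CarCheck b d Mv) := by
  unfold p1CarCheck; infer_instance

/-- The checks for the in-layer legs (bond = leg: `μ = ½Φ(F_b(d))`), both parities (by `decide`). -/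
theorem p1CarCheck_in : ∀ b : Bool, ∀ d ∈ p1StencilIn, p1CarCheck b d (p1Frame b d) := by decide

/-- The checks for the route legs as FIRST leg of the vertical bond at the base (`μ = (0,0,h) = ½Φ(0,0,2)`). -/
theorem p1CarCheck_v1 : ∀ b : Bool, ∀ d ∈ p1RouteDirs b, p1CarCheck b d (0, 0, 2) := by decide

/-- The checks for the route legs as SECOND leg of the vertical bond arriving at the head (`μ = Φ(F_b(d)) − (0,0,h)`). -/
theorem p1CarCheck_v2 : ∀ b : Bool, ∀ d ∈ p1RouteDirs b, p1CarCheck b d (2 • p1Frame b d - (0, 0, 2)) := by decide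

/-! ## The vertex second moment of the carriers, expanded in the frame -/

/-- Casts of the table coordinates as real double sums. -/
theorem p1CarS1_cast (b : Bool) (d : ℤ × ℤ × ℤ) :
    ((p1CarS1 b d).1 : ℝ) = ∑ oπ ∈ p1Carriers b d, ∑ m : Fin 4, ((p1Frame b (p1VertOff (parOf b oπ.1) oπ.2 m - oπ.1)).1 : ℝ) ∧
    ((p1CarS1 b d).2.1 : ℝ) = ∑ oπ ∈ p1Carriers b d, ∑ m : Fin 4, ((p1Frame b (p1VertOff (parOf b oπ.1) oπ.2 m - oπ.1)).2.1 : ℝ) ∧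
    ((p1CarS1 b d).2.2 : ℝ) = ∑ oπ ∈ p1Carriers b d, ∑ m : Fin 4, ((p1Frame b (p1VertOff (parOf b oπ.1) oπ.2 m - oπ.1)).2.2 : ℝ) := by
  refine ⟨?_, ?_, ?_⟩ <;> simp [p1CarS1, Prod.fst_sum, Prod.snd_sum]

/-- Casts of the second-moment table coordinates as real double sums. -/
theorem p1CarQ_cast (b : Bool) (d : ℤ × ℤ × ℤ) :
    ((p1CarQ b d).1 : ℝ) = ∑ oπ ∈ p1Carriers b d, ∑ m : Fin 4, ((p1Frame b (p1VertOff (parOf b oπ.1) oπ.2 m - oπ.1)).1 : ℝ) ^ 2 ∧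
    ((p1CarQ b d).2.1 : ℝ) = ∑ oπ ∈ p1Carriers b d, ∑ m : Fin 4, ((p1Frame b (p1VertOff (parOf b oπ.1) oπ.2 m - oπ.1)).2.1 : ℝ) ^ 2 ∧
    ((p1CarQ b d).2.2 : ℝ) = ∑ oπ ∈ p1Carriers b d, ∑ m : Fin 4, ((p1Frame b (p1VertOff (parOf b oπ.1) oπ.2 m - oπ.1)).2.2 : ℝ) ^ 2 := by
  refine ⟨?_, ?_, ?_⟩ <;> simp [p1CarQ, Prod.fst_sum, Prod.snd_sum]

/-- **The carriers' vertex second moment about `P`, expanded**: with `D = y_x − P`, `N = 4n`, `S = p1CarS1`, `Q = p1CarQ`: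
`Σ_{(o,π)} Σ_m |y_{(x−o)+o_m} − P|² = N|D|² + 2⟨D, Φ(S)⟩ + ((a²/4)Q₁ + (a²/12)Q₂ + h²Q₃)`. [folklore] -/
theorem carrier_moment_eq (a h : ℝ) {x : ℤ × ℤ × ℤ} {b : Bool} (hb : p1Par x = b) (d : ℤ × ℤ × ℤ) (P : Fin 3 → ℝ) :
    ∑ oπ ∈ p1Carriers b d, ∑ m : Fin 4, fpSq (fun k => hcpSite a h ((x - oπ.1) + p1VertOff (p1Par (x - oπ.1)) oπ.2 m) k - P k) =
      4 * ((p1Carriers b d).card : ℝ) * fpSq (fun k => hcpSite a h x k - P k) +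
        2 * fpDot (fun k => hcpSite a h x k - P k) (p1FrameVec a h (p1CarS1 b d)) +
        (a ^ 2 / 4 * ((p1CarQ b d).1 : ℝ) + a ^ 2 / 12 * ((p1CarQ b d).2.1 : ℝ) + h ^ 2 * ((p1CarQ b d).2.2 : ℝ)) := by
  set D : Fin 3 → ℝ := fun k => hcpSite a h x k - P k with hD
  have hterm : ∀ oπ ∈ p1Carriers b d, ∀ m : Fin 4,
      fpSq (fun k => hcpSite a h ((x - oπ.1) + p1VertOff (p1Par (x - oπ.1)) oπ.2 m) k - P k) =
        fpSq D + 2 * (D 0 * (a / 2 * ((p1Frame b (p1VertOff (parOf b oπ.1) oπ.2 m - oπ.1)).1 : ℝ)) +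
          D 1 * (a * √3 / 6 * ((p1Frame b (p1VertOff (parOf b oπ.1) oπ.2 m - oπ.1)).2.1 : ℝ)) +
          D 2 * (h * ((p1Frame b (p1VertOff (parOf b oπ.1) oπ.2 m - oπ.1)).2.2 : ℝ))) +
        (a ^ 2 / 4 * ((p1Frame b (p1VertOff (parOf b oπ.1) oπ.2 m - oπ.1)).1 : ℝ) ^ 2 +
          a ^ 2 / 12 * ((p1Frame b (p1VertOff (parOf b oπ.1) oπ.2 m - oπ.1)).2.1 : ℝ) ^ 2 +
          h ^ 2 * ((p1Frame b (p1VertOff (parOf b oπ.1) oπ.2 m - oπ.1)).2.2 : ℝ) ^ 2) := by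
    intro oπ _ m
    have hpar : p1Par (x - oπ.1) = parOf b oπ.1 := by rw [p1Par_sub, hb]
    set u : ℤ × ℤ × ℤ := p1VertOff (parOf b oπ.1) oπ.2 m - oπ.1 with hu
    have hxu : (x - oπ.1) + p1VertOff (p1Par (x - oπ.1)) oπ.2 m = x + u := by rw [hpar, hu]; abel
    have hk : ∀ k, hcpSite a h ((x - oπ.1) + p1VertOff (p1Par (x - oπ.1)) oπ.2 m) k - P k = D k + p1FrameVec a h (p1Frame b u) k := by
      intro k
      rw [hxu, ← hcpSite_shift_eq_frame a h hb u k, hD]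
      ring
    have h3 : (√3 : ℝ) ^ 2 = 3 := Real.sq_sqrt (by norm_num)
    simp only [fpSq, hk, p1FrameVec_apply0, p1FrameVec_apply1, p1FrameVec_apply2]
    linear_combination (a ^ 2 / 36 * ((p1Frame b u).2.1 : ℝ) ^ 2) * h3
  obtain ⟨s0, s1, s2⟩ := p1CarS1_cast b d
  obtain ⟨q0, q1, q2⟩ := p1CarQ_cast b d
  rw [Finset.sum_congr rfl fun oπ hoπ => Finset.sum_congr rfl fun m _ => hterm oπ hoπ m]
  simp only [Finset.sum_add_distrib, Finset.sum_const, Finset.card_univ, Fintype.card_fin, ← Finset.mul_sum]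
  simp only [fpDot, p1FrameVec_apply0, p1FrameVec_apply1, p1FrameVec_apply2, s0, s1, s2, q0, q1, q2, Finset.mul_sum, nsmul_eq_mul]
  push_cast
  ring

/-! ## The moment bound against the bond-midpoint distance -/

/-- **The abstract moment bound**: `N|D|² + 2⟨D,U⟩ + Q ≤ N·(27/25)·m²` from `|D + μ| = m ≥ 93/5`, `|U/N − μ| ≤ 1/2` and
`Q − |U|²/N ≤ (3/5)N` (parallel axis: `N|D|² + 2⟨D,U⟩ = N|D + U/N|² − |U|²/N`; `(m + 1/2)² + 3/5 ≤ (27/25)m²`). [folklore] -/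
theorem moment_abstract {N : ℝ} {D U μ : Fin 3 → ℝ} {Q m : ℝ} (hN : 0 < N) (hm0 : 0 ≤ m) (hDμ : fpSq (D + μ) = m ^ 2)
    (hw : fpSq (fun k => U k / N - μ k) ≤ (1 / 2) ^ 2) (hvar : Q - fpSq U / N ≤ 3 / 5 * N) (hm : 93 / 5 ≤ m) :
    N * fpSq D + 2 * fpDot D U + Q ≤ N * (27 / 25 * m ^ 2) := by
  have e : N * fpSq D + 2 * fpDot D U = N * fpSq (D + fun k => U k / N) - fpSq U / N := by
    have hN' : N ≠ 0 := hN.ne'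
    simp only [fpSq, fpDot, Pi.add_apply]
    field_simp
    ring
  have hsplit : (D + fun k => U k / N) = (D + μ) + (fun k => U k / N - μ k) := by
    funext k; simp only [Pi.add_apply]; ring
  have hadd : fpSq (D + fun k => U k / N) ≤ (m + 1 / 2) ^ 2 := by
    rw [hsplit]; exact fpSq_add_le_sq hm0 (by norm_num) hDμ hw
  rw [e]
  have h1 : N * fpSq (D + fun k => U k / N) ≤ N * (m + 1 / 2) ^ 2 := mul_le_mul_of_nonneg_left hadd hN.le
  have h2 : (m + 1 / 2) ^ 2 + 3 / 5 ≤ 27 / 25 * m ^ 2 := by nlinarith [mul_nonneg (sub_nonneg.2 hm) hm0]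
  have h3 := mul_le_mul_of_nonneg_left h2 hN.le
  linarith
set_option maxHeartbeats 400000 in
/-- **The integer checks imply the two real side conditions on the box** (`a ≤ 0.97139`, `h ≤ 0.79304`; abstract integer data). -/
theorem check_real {a h : ℝ} (ha : 0 < a) (hh : 0 < h) (ha2 : a ≤ 97139 / 100000) (hh2 : h ≤ 79304 / 100000)
    {n : ℕ} (hn : 0 < n) {S Q Mv : ℤ × ℤ × ℤ}
    (hW : 9437 * (3 * (2 * S.1 - 4 * (n : ℤ) * Mv.1) ^ 2 + (2 * S.2.1 - 4 * (n : ℤ) * Mv.2.1) ^ 2) +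
      75480 * (2 * S.2.2 - 4 * (n : ℤ) * Mv.2.2) ^ 2 ≤ 120000 * (4 * (n : ℤ)) ^ 2)
    (hA1 : 0 ≤ 4 * (n : ℤ) * Q.1 - S.1 ^ 2) (hA2 : 0 ≤ 4 * (n : ℤ) * Q.2.1 - S.2.1 ^ 2) (hA3 : 0 ≤ 4 * (n : ℤ) * Q.2.2 - S.2.2 ^ 2)
    (hV : 9437 * (3 * (4 * (n : ℤ) * Q.1 - S.1 ^ 2) + (4 * (n : ℤ) * Q.2.1 - S.2.1 ^ 2)) + 75480 * (4 * (n : ℤ) * Q.2.2 - S.2.2 ^ 2) ≤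
      72000 * (4 * (n : ℤ)) ^ 2) :
    fpSq (fun k => p1FrameVec a h S k / (4 * (n : ℝ)) - p1FrameVec a h Mv k / 2) ≤ (1 / 2) ^ 2 ∧
    (a ^ 2 / 4 * (Q.1 : ℝ) + a ^ 2 / 12 * (Q.2.1 : ℝ) + h ^ 2 * (Q.2.2 : ℝ)) - fpSq (p1FrameVec a h S) / (4 * (n : ℝ)) ≤
      3 / 5 * (4 * (n : ℝ)) := by
  have hsa : a ^ 2 ≤ 9437 / 10000 := by nlinarith
  have hsh : h ^ 2 ≤ 6290 / 10000 := by nlinarith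
  have h3 : (√3 : ℝ) ^ 2 = 3 := Real.sq_sqrt (by norm_num)
  have hnR : (0 : ℝ) < (n : ℝ) := by exact_mod_cast hn
  have h4n : (0 : ℝ) < 4 * (n : ℝ) := by positivity
  have hW' : (9437 : ℝ) * (3 * (2 * (S.1 : ℝ) - 4 * (n : ℝ) * (Mv.1 : ℝ)) ^ 2 + (2 * (S.2.1 : ℝ) - 4 * (n : ℝ) * (Mv.2.1 : ℝ)) ^ 2) +
      75480 * (2 * (S.2.2 : ℝ) - 4 * (n : ℝ) * (Mv.2.2 : ℝ)) ^ 2 ≤ 120000 * (4 * (n : ℝ)) ^ 2 := by exact_mod_cast hW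
  have hA1' : (0 : ℝ) ≤ 4 * (n : ℝ) * (Q.1 : ℝ) - (S.1 : ℝ) ^ 2 := by exact_mod_cast hA1
  have hA2' : (0 : ℝ) ≤ 4 * (n : ℝ) * (Q.2.1 : ℝ) - (S.2.1 : ℝ) ^ 2 := by exact_mod_cast hA2
  have hA3' : (0 : ℝ) ≤ 4 * (n : ℝ) * (Q.2.2 : ℝ) - (S.2.2 : ℝ) ^ 2 := by exact_mod_cast hA3
  have hV' : (9437 : ℝ) * (3 * (4 * (n : ℝ) * (Q.1 : ℝ) - (S.1 : ℝ) ^ 2) + (4 * (n : ℝ) * (Q.2.1 : ℝ) - (S.2.1 : ℝ) ^ 2)) +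
      75480 * (4 * (n : ℝ) * (Q.2.2 : ℝ) - (S.2.2 : ℝ) ^ 2) ≤ 72000 * (4 * (n : ℝ)) ^ 2 := by exact_mod_cast hV
  constructor
  · have hn' : (n : ℝ) ≠ 0 := hnR.ne'
    have e0 : p1FrameVec a h S 0 / (4 * (n : ℝ)) - p1FrameVec a h Mv 0 / 2 =
        a / 2 * (2 * (S.1 : ℝ) - 4 * (n : ℝ) * (Mv.1 : ℝ)) / (8 * (n : ℝ)) := by
      simp only [p1FrameVec_apply0]; field_simp; ring
    have e1 : p1FrameVec a h S 1 / (4 * (n : ℝ)) - p1FrameVec a h Mv 1 / 2 =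
        a * √3 / 6 * (2 * (S.2.1 : ℝ) - 4 * (n : ℝ) * (Mv.2.1 : ℝ)) / (8 * (n : ℝ)) := by
      simp only [p1FrameVec_apply1]; field_simp; ring
    have e2 : p1FrameVec a h S 2 / (4 * (n : ℝ)) - p1FrameVec a h Mv 2 / 2 =
        h * (2 * (S.2.2 : ℝ) - 4 * (n : ℝ) * (Mv.2.2 : ℝ)) / (8 * (n : ℝ)) := by
      simp only [p1FrameVec_apply2]; field_simp; ring
    have hsq : fpSq (fun k => p1FrameVec a h S k / (4 * (n : ℝ)) - p1FrameVec a h Mv k / 2) =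
        ((a / 2) ^ 2 * (2 * (S.1 : ℝ) - 4 * (n : ℝ) * (Mv.1 : ℝ)) ^ 2 + (a * √3 / 6) ^ 2 * (2 * (S.2.1 : ℝ) - 4 * (n : ℝ) * (Mv.2.1 : ℝ)) ^ 2 +
          h ^ 2 * (2 * (S.2.2 : ℝ) - 4 * (n : ℝ) * (Mv.2.2 : ℝ)) ^ 2) / (8 * (n : ℝ)) ^ 2 := by
      simp only [fpSq, e0, e1, e2]
      field_simp
    have h36 : (a * √3 / 6) ^ 2 = a ^ 2 / 12 := by
      rw [show (a * √3 / 6) ^ 2 = a ^ 2 * (√3) ^ 2 / 36 by ring, h3]; ring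
    rw [hsq, h36, div_le_iff₀ (by positivity)]
    nlinarith [mul_le_mul_of_nonneg_right hsa (sq_nonneg (2 * (S.1 : ℝ) - 4 * (n : ℝ) * (Mv.1 : ℝ))),
      mul_le_mul_of_nonneg_right hsa (sq_nonneg (2 * (S.2.1 : ℝ) - 4 * (n : ℝ) * (Mv.2.1 : ℝ))),
      mul_le_mul_of_nonneg_right hsh (sq_nonneg (2 * (S.2.2 : ℝ) - 4 * (n : ℝ) * (Mv.2.2 : ℝ)))]
  · rw [fpSq_p1FrameVec]
    have e : (a ^ 2 / 4 * (Q.1 : ℝ) + a ^ 2 / 12 * (Q.2.1 : ℝ) + h ^ 2 * (Q.2.2 : ℝ)) -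
        (a ^ 2 / 4 * (S.1 : ℝ) ^ 2 + a ^ 2 / 12 * (S.2.1 : ℝ) ^ 2 + h ^ 2 * (S.2.2 : ℝ) ^ 2) / (4 * (n : ℝ)) =
        (a ^ 2 / 4 * (4 * (n : ℝ) * (Q.1 : ℝ) - (S.1 : ℝ) ^ 2) + a ^ 2 / 12 * (4 * (n : ℝ) * (Q.2.1 : ℝ) - (S.2.1 : ℝ) ^ 2) +
          h ^ 2 * (4 * (n : ℝ) * (Q.2.2 : ℝ) - (S.2.2 : ℝ) ^ 2)) / (4 * (n : ℝ)) := by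
      field_simp
      ring
    rw [e, div_le_iff₀ h4n]
    nlinarith [mul_le_mul_of_nonneg_right hsa hA1', mul_le_mul_of_nonneg_right hsa hA2', mul_le_mul_of_nonneg_right hsh hA3']

/-- **THE MOMENT HYPOTHESIS OF THE JENSEN CAPACITY.**  For a leg `(x, d)` with `x` of parity `b`, a bond-midpoint offset `μ = ½Φ(Mv)`
passing the class checks, and `m = |y_x + μ − y_p| ≥ 93/5` (box `a ≤ 0.97139`, `h ≤ 0.79304`):
`(|T'|/4)·Σ_{carriers} Σ_m |y_{T',m} − y_p|² ≤ n·|T'|·((27/25)m²)` — the hypothesis `hmom` of `cap_ge_carriers_tangent` with `X = (27/25)m²`.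
NOT a proof of H12⋆, NOT summit progress. [folklore] -/
theorem carriers_moment_le {a h : ℝ} (ha : 0 < a) (hh : 0 < h) (ha2 : a ≤ 97139 / 100000) (hh2 : h ≤ 79304 / 100000)
    (p x d : ℤ × ℤ × ℤ) {b : Bool} (hb : p1Par x = b) {Mv : ℤ × ℤ × ℤ} (hchk : p1CarCheck b d Mv) (hn : 0 < (p1Carriers b d).card)
    {m : ℝ} (hm0 : 0 ≤ m) (hm : 93 / 5 ≤ m)
    (hDμ : fpSq ((fun k => hcpSite a h x k - hcpSite a h p k) + fun k => p1FrameVec a h Mv k / 2) = m ^ 2) :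
    √3 * a ^ 2 * h / 48 * ∑ oπ ∈ p1Carriers b d, ∑ m' : Fin 4,
        fpSq (fun k => hcpSite a h ((x - oπ.1) + p1VertOff (p1Par (x - oπ.1)) oπ.2 m') k - hcpSite a h p k) ≤
      ((p1Carriers b d).card : ℝ) * (√3 * a ^ 2 * h / 12) * (27 / 25 * m ^ 2) := by
  rw [carrier_moment_eq a h hb d]
  obtain ⟨hW, hA1, hA2, hA3, hV⟩ := hchk
  obtain ⟨hw, hvar⟩ := check_real ha hh ha2 hh2 hn hW hA1 hA2 hA3 hV
  have hN : (0 : ℝ) < 4 * ((p1Carriers b d).card : ℝ) := by positivity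
  have key := moment_abstract (D := fun k => hcpSite a h x k - hcpSite a h p k) (U := p1FrameVec a h (p1CarS1 b d))
    (μ := fun k => p1FrameVec a h Mv k / 2) hN hm0 hDμ hw hvar hm
  have hV : 0 ≤ √3 * a ^ 2 * h / 48 := by positivity
  have := mul_le_mul_of_nonneg_left key hV
  refine le_trans this (le_of_eq ?_)
  ring

end Summit.AtomisticToContinuum.Crystallization.Theorems.StrictSplittingRuleBirth

end
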